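import Literature.NumberTheory.Automorphic.Liu2021.AppendixC.JacobianFanPullbackWord
import Literature.NumberTheory.Automorphic.Liu2021.AppendixC.HeckeEndomorphismComplexWord
import Literature.NumberTheory.Automorphic.Liu2021.AppendixC.HeckeTranslateLevelQuotient
import Literature.AlgebraicGeometry.Motives.BaseChangeProofs
import HarnessLib

/-!
# The TRACE WORD of the level cover `u : X_N → X_K` of a §4.2 tower in MATRIX form: `Wt ≫ v_N = v_K ≫ t_ℂ` with
# `Wt = Σ_{c′} πY_K (bN c′) ≫ (m c′ • (tu c′)^*) ≫ ιY_N c′` (Liu 2021 §4.2 / App. C; Lang VIII §6 Thm. 13; LR22 Prop. 3.5.1)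

Topic `NumberTheory/Automorphic/Liu2021/AppendixC`; namespace `Literature.NumberTheory.Automorphic.Liu2021.AppendixC.Sec42Data.HeckeTranslates`.
PROOF FILE (theorems only; no definition, no named fact, no instance, no `sorry`).  Sequel of ★ `JacobianFanPullbackWord` (the fan pinning
`p^* p_* = Σ_δ δ_*` with piecewise Galois groups and multiplicities) and ★ `HeckeEndomorphismComplexWord` (the Y-level words, (N1)).

SETTING ([Liu2021] §4.2 l. 2053–2074, as in ★ `HeckeEndomorphismComplexWord` with `L = ℂ`).  A §4.2 datum `C` over the CM extension `E/F`,
`[Algebra E ℂ]`; small levels `N ≤ K`; the level projection `u = u^N_K : X_N → X_K` realised as a quotient of `X_N` by a FINITE group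
`act : Δ →* Aut X_N` for separated test objects ([Milne2005ShimuraVarieties] §5 «`Sh_K = Sh_{K′}/(K/K′)`», Rem. 5.29 (c); ★
`exists_finite_isSepQuotient_map'`, which also records `act δ = T_k`); an Albanese trace `t : A_K → A_N` pinned by the deck group,
`Alb_u ≫ t = Σ_δ Alb(act δ)` ([Lang1983AbelianVarieties] VIII §6 Thm. 13, ★ `Albanese.exists_trace_of_isSepQuotient_complex`; the `t`/`ht` of ★ (P3)
`heckeEnd_eq_pushPull_of_aut`); PIECEWISE COMPLEX MODELS of `A_N ⊗ ℂ` and `A_K ⊗ ℂ` — smooth projective curves `E_• c → X_• ⊗ ℂ` forming colimit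
cofans, Jacobians `J_• c`, biproduct fans `π/ι` on abelian varieties `Y_•`, comparison homomorphisms `v_• : Y_• → A_• ⊗ ℂ`, the two
`α`-compatibilities (the `GSComplexModel` fields of the d6 frame, ★ `Albanese.exists_complexJacobian_biproduct_theta_cofan`); and the piece
maps `tu c′ : E_N c′ → E_K (bN c′)` of `u_ℂ` (★ `Over.exists_pieceMap_family_of_irreducibleSpace`).

* `map_baseChange_word` — ★ `albTr_baseChange_word` for ANY tower morphism `f : X_N → X_K` (e.g. a deck automorphism): with piece maps
  `tp c′ : E_N c′ → E_K (φ c′)` of `f_ℂ`, `v_N ≫ (Alb f)_ℂ = (Σ_{c′} πY_N c′ ≫ Nm_{tp c′} ≫ ιY_K (φ c′)) ≫ v_K` ((N1) ★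
  `Albanese.inj_comp_map_baseChange_eq_pushforward_comp_inj` summed over the fan);
* **`exists_fan_traceWord`** ((P-ii)) — for every piece `c′`: the finite group `H c′ ≤ Aut (E_N c′)` of lifts of its stabiliser, FOR WHICH
  `tu c′` IS A QUOTIENT for separated test objects; the pinned pull-back `ttH c′` (`Nm_{tu c′} ≫ ttH c′ = Σ_{h ∈ H c′} h_*`); a multiplicity
  `m c′ ≥ 1`; and **`(Σ_{c′} πY_K (bN c′) ≫ (m c′ • ttH c′) ≫ ιY_N c′) ≫ v_N = v_K ≫ t_ℂ`** — verbatim the `(Hu, hqu, tt, htt)` inputs of ★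
  `Jacobian.exists_entry_levelAdjoint(_smul)` per piece and the `(bN, tt := m • ttH, hWt)` input of ★
  `algEquiv_symm_endAlgebraBaseChange_heckeEnd_eq_smul_fan_sum`.  Proof: the fan pinning and cancellation of ★ `Jacobian.exists_fan_pullback_word`
  on `u_ℂ` (complexified quotient by ★ `isSepQuotient_baseChangeHom_of_isProjectiveOver`), the deck words `map_baseChange_word`, and the
  cancellation argument of ★ `trace_baseChange_word_of_cancel` ([LangeRodriguez2022] Prop. 3.5.1).

WHY THE MULTIPLICITY.  The trace `t` is pinned by ALL of `Δ = K/N`; the named fact (F-P2) and ★ `Jacobian.exists_entry_levelAdjoint` need the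
FAITHFUL piece group `H c′`; the two differ on the piece `c′` exactly by `m c′ = #ker(Stab_Δ(c′) → Aut (E_N c′))` (`= 1` iff `K/N` acts piecewise
faithfully on `X_N ⊗ ℂ`, true at neat level but not a theorem of the generic tower), so the word entry is `m c′ • ttH c′`.

Cell `hodgecm-mathlib` (D-0151), crux `HLiu418` = stmt-HodgeConjecture-24832, d6 line, `stub_RosH` glue, socket (G3)/(P-ii) of the frame's
`slot_letters` (A-p02 (g14) 2026-08-30 05:21Z/05:34Z; d6 pen A-plan2 (g12) 05:33Z).  COUNT-NEUTRAL capital: HC_CM is proved only modulo the 7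
printed citations until rung 0 closes; nothing here discharges a binder.

## References
* [Liu2021] Y. Liu, *Fourier–Jacobi cycles and arithmetic relative trace formula*, Camb. J. Math. 9 (2021): Def. 2.3 (FJcycle.tex l. 1206–1208),
  §2.1 proof of the Proposition (l. 1194–1200), §4.2 (l. 2070–2074), p. 133 (before (D.3)).
* [Lang1983AbelianVarieties] S. Lang, *Abelian Varieties* (1983), Ch. VIII §6 Thm. 13 (pp. 224–227).
* [LangeRodriguez2022] H. Lange, R. E. Rodríguez, *Decomposition of Jacobians by Prym Varieties*, LNM 2310 (2022), §3.5.1 Prop. 3.5.1 (p. 65).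
* [Lange2023AbelianVarietiesComplex] H. Lange, *Abelian Varieties over the Complex Numbers* (2023), §4.5.2 (the norm map `N_f`).
* [Milne2005ShimuraVarieties] J. S. Milne, *Introduction to Shimura varieties* (2005), §5 p. 57 L7–12, Rem. 5.29 (c) p. 65.
* [MumfordAV1970] D. Mumford, *Abelian Varieties* (1970), §7 Thm. p. 66 and Remark; §19 (Hom(X,Y), first paragraph).
-/

set_option autoImplicit false

noncomputable section

open CategoryTheory CategoryTheory.Limits AlgebraicGeometry MonoidalCategory CartesianMonoidalCategory NumberField
open Literature.AlgebraicGeometry.Motives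

namespace Literature.NumberTheory.Automorphic.Liu2021.AppendixC

/-! ## §2 The trace word of the level cover `u : X_N → X_K` of a §4.2 tower, in matrix form -/

section Sec42

open AbelianVariety (bcSpec bcFunctor)

-- `(A.baseChange L).X` is `(bcFunctor E L).obj A.X` only up to unfolding `AbelianVariety.baseChange` (as in ★ `HeckeEndomorphismComplexWord`)
set_option backward.isDefEq.respectTransparency false

variable {F E : Type} [Field F] [NumberField F] [IsTotallyReal F] [Field E] [NumberField E] [Algebra F E]
  [IsTotallyComplex E] [Algebra.IsQuadraticExtension F E]
variable {P5 : PropC5Data F E} {isotropicAt : ℕ → Prop}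

namespace Sec42Data.HeckeTranslates

variable {C : Sec42Data P5 isotropicAt} (T : C.HeckeTranslates) [Algebra E ℂ]
variable {N K : C5.SmallLevel C.S.K₀}
-- piecewise model of `A_N ⊗ ℂ`, with its fan `πN/ιN`
variable {CN : Type} [Fintype CN] (EN : CN → SchemeOver ℂ) (eN : ∀ c, EN c ⟶ (bcFunctor E ℂ).obj (C.X N))
  (JN : ∀ c, Jacobian (EN c)) (YN : AbelianVariety ℂ) (πN : ∀ c, YN ⟶ (JN c).J) (ιN : ∀ c, (JN c).J ⟶ YN)
  (vN : YN ⟶ (C.A N).baseChange ℂ) (lN : ∀ c, EN c ⊗ EN c ⟶ (bcFunctor E ℂ).obj (C.alb N).nabla.N)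
-- piecewise model of `A_K ⊗ ℂ`, with its fan `πK/ιK`
variable {CK : Type} [Fintype CK] (EK : CK → SchemeOver ℂ) (eK : ∀ c, EK c ⟶ (bcFunctor E ℂ).obj (C.X K))
  (JK : ∀ c, Jacobian (EK c)) (YK : AbelianVariety ℂ) (πK : ∀ c, YK ⟶ (JK c).J) (ιK : ∀ c, (JK c).J ⟶ YK)
  (vK : YK ⟶ (C.A K).baseChange ℂ) (lK : ∀ c, EK c ⊗ EK c ⟶ (bcFunctor E ℂ).obj (C.alb K).nabla.N)

omit [Fintype CK] in
/-- **The Y-level word of the Albanese map of ANY tower morphism `f : X_N → X_K`** (★ `albTr_baseChange_word` for a general `f`, e.g. a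
deck automorphism `act δ` of the level cover): with piece maps `tp c′ : E_N c′ → E_K (φ c′)` of `f_ℂ` and `α`-compatible models,
`v_N ≫ (Alb f)_ℂ = (Σ_{c′} πY_N c′ ≫ Nm_{tp c′} ≫ ιY_K (φ c′)) ≫ v_K` ((N1) ★ `Albanese.inj_comp_map_baseChange_eq_pushforward_comp_inj`
summed over the fan). [cite: Liu2021, Def. 2.3 (FJcycle.tex l. 1206–1208), §2.1 proof of the Proposition (l. 1194–1200)]
[cite: Lange2023AbelianVarietiesComplex, §4.5.2 (the norm map N_f)] -/
theorem map_baseChange_word (htotN : ∑ c, πN c ≫ ιN c = 𝟙 YN)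
    (hlN : ∀ c, lN c ≫ (bcFunctor E ℂ).map (C.alb N).nabla.incl = (eN c ⊗ₘ eN c) ≫ Functor.LaxMonoidal.μ (bcFunctor E ℂ) (C.X N) (C.X N))
    (hlαN : ∀ c, lN c ≫ (bcFunctor E ℂ).map (C.alb N).α = (JN c).diff ≫ (ιN c ≫ vN).hom.hom.hom)
    (hlK : ∀ c, lK c ≫ (bcFunctor E ℂ).map (C.alb K).nabla.incl = (eK c ⊗ₘ eK c) ≫ Functor.LaxMonoidal.μ (bcFunctor E ℂ) (C.X K) (C.X K))
    (hlαK : ∀ c, lK c ≫ (bcFunctor E ℂ).map (C.alb K).α = (JK c).diff ≫ (ιK c ≫ vK).hom.hom.hom)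
    (f : C.X N ⟶ C.X K) (φ : CN → CK) (tp : ∀ c', EN c' ⟶ EK (φ c'))
    (htp : ∀ c', tp c' ≫ eK (φ c') = eN c' ≫ (bcFunctor E ℂ).map f) :
    vN ≫ AbelianVariety.Hom.baseChange ℂ ((C.alb N).map (C.alb K) f) =
      (∑ c', πN c' ≫ (JN c').pushforward (JK (φ c')) (tp c') ≫ ιK (φ c')) ≫ vK := by
  have key : ∀ c', (ιN c' ≫ vN) ≫ AbelianVariety.Hom.baseChange ℂ ((C.alb N).map (C.alb K) f) =
      (JN c').pushforward (JK (φ c')) (tp c') ≫ ιK (φ c') ≫ vK := fun c' =>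
    (C.alb N).inj_comp_map_baseChange_eq_pushforward_comp_inj ℂ (C.alb K) f EN eN JN (fun c => ιN c ≫ vN) lN
      EK eK JK (fun c => ιK c ≫ vK) lK φ tp hlN hlαN hlK hlαK htp c'
  calc vN ≫ AbelianVariety.Hom.baseChange ℂ ((C.alb N).map (C.alb K) f)
      = (∑ c, πN c ≫ ιN c) ≫ vN ≫ AbelianVariety.Hom.baseChange ℂ ((C.alb N).map (C.alb K) f) := by
        rw [htotN, Category.id_comp]
    _ = ∑ c', πN c' ≫ ((ιN c' ≫ vN) ≫ AbelianVariety.Hom.baseChange ℂ ((C.alb N).map (C.alb K) f)) := by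
        rw [Preadditive.sum_comp]; exact Finset.sum_congr rfl fun c _ => by simp only [Category.assoc]
    _ = ∑ c', πN c' ≫ (JN c').pushforward (JK (φ c')) (tp c') ≫ ιK (φ c') ≫ vK :=
        Finset.sum_congr rfl fun c' _ => by rw [key c']
    _ = (∑ c', πN c' ≫ (JN c').pushforward (JK (φ c')) (tp c') ≫ ιK (φ c')) ≫ vK := by
        rw [Preadditive.sum_comp]; exact Finset.sum_congr rfl fun c _ => by simp only [Category.assoc]

/-- **(P-ii) THE TRACE WORD OF THE LEVEL COVER IN MATRIX FORM** (d6 `stub_RosH` glue, socket (G3) of the frame's `slot_letters`).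
Data: small levels `N ≤ K`; the level projection `u : X_N → X_K` realised as a quotient of `X_N` by a FINITE group `act : Δ →* Aut X_N` for
separated test objects ([Milne2005ShimuraVarieties] §5 «`Sh_K = Sh_{K′}/(K/K′)`»; ★ `exists_finite_isSepQuotient_map'`); an Albanese trace
`t : A_K → A_N` of `u` pinned by the deck group, `Alb_u ≫ t = Σ_δ Alb(act δ)` ([Lang1983AbelianVarieties] VIII §6 Thm. 13; ★
`Albanese.exists_trace_of_isSepQuotient_complex`); piecewise complex models of `A_N ⊗ ℂ`, `A_K ⊗ ℂ` (smooth projective curves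
`E_• c → X_• ⊗ ℂ` forming colimit cofans, Jacobians, biproduct fans `π/ι` on `Y_•`, comparison maps `v_•`, `α`-compatibilities — the
`GSComplexModel` fields); the piece maps `tu c′ : E_N c′ → E_K (bN c′)` of `u_ℂ`.  THEN for every piece `c′` there are: the finite group
`H c′ ≤ Aut (E_N c′)` of lifts of its stabiliser, for which `tu c′` IS A QUOTIENT for separated test objects (the `Hu`/`hqu` input of ★
`Jacobian.exists_entry_levelAdjoint`); the pinned pull-back `ttH c′` (`Nm_{tu c′} ≫ ttH c′ = Σ_{h ∈ H c′} h_*`, its `tt`/`htt` input); a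
multiplicity `m c′ ≥ 1` (`= #ker(Stab_Δ(c′) → Aut (E_N c′))`; `= 1` iff `K/N` acts piecewise faithfully); and THE TRACE WORD INTERTWINES `t`:
**`(Σ_{c′} πY_K (bN c′) ≫ (m c′ • ttH c′) ≫ ιY_N c′) ≫ v_N = v_K ≫ t_ℂ`** — the `(bN, tt := m • ttH, hWt)` input of ★
`algEquiv_symm_endAlgebraBaseChange_heckeEnd_eq_smul_fan_sum`.  Proof: §1 (Y-level `p^* p_* = Σ_δ δ_*` + cancellation of the word of `u`)
and the intertwining of the deck words (`map_baseChange_word`), as in ★ `trace_baseChange_word_of_cancel` ([LangeRodriguez2022] Prop. 3.5.1).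
[cite: Lang1983AbelianVarieties, Ch. VIII §6, Thm. 13 (pp. 224–227)] [cite: LangeRodriguez2022, §3.5.1 Prop. 3.5.1 (p. 65)]
[cite: Liu2021, §4.2 (FJcycle.tex l. 2070–2074) and p. 133 (before (D.3))] [cite: Milne2005ShimuraVarieties, §5 p. 57 L7–12 and Rem. 5.29 (c) p. 65]
[cite: MumfordAV1970, §7 Thm. p. 66 and Remark] -/
theorem exists_fan_traceWord (h : N ≤ K)
    {Δ : Type} [Group Δ] [Fintype Δ] (act : Δ →* Aut (C.X N))
    (hp : IsSepQuotient (fun δ => act δ) (C.cpt.X.map (homOfLE h)))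
    (t : C.A K ⟶ C.A N)
    (ht : (C.alb N).map (C.alb K) (C.cpt.X.map (homOfLE h)) ≫ t = ∑ δ, (C.alb N).map (C.alb N) (act δ).hom)
    (hcN : IsColimit (Cofan.mk ((bcFunctor E ℂ).obj (C.X N)) eN)) (hEN : ∀ c, IsSmoothProjective 1 (EN c))
    (hcK : IsColimit (Cofan.mk ((bcFunctor E ℂ).obj (C.X K)) eK)) (hEK : ∀ c, IsSmoothProjective 1 (EK c))
    (htotN : ∑ c, πN c ≫ ιN c = 𝟙 YN) (hιπN : ∀ c, ιN c ≫ πN c = 𝟙 _) (hιπN' : ∀ c₁ c₂, c₁ ≠ c₂ → ιN c₁ ≫ πN c₂ = 0)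
    (htotK : ∑ c, πK c ≫ ιK c = 𝟙 YK) (hιπK : ∀ c, ιK c ≫ πK c = 𝟙 _) (hιπK' : ∀ c₁ c₂, c₁ ≠ c₂ → ιK c₁ ≫ πK c₂ = 0)
    (hlN : ∀ c, lN c ≫ (bcFunctor E ℂ).map (C.alb N).nabla.incl = (eN c ⊗ₘ eN c) ≫ Functor.LaxMonoidal.μ (bcFunctor E ℂ) (C.X N) (C.X N))
    (hlαN : ∀ c, lN c ≫ (bcFunctor E ℂ).map (C.alb N).α = (JN c).diff ≫ (ιN c ≫ vN).hom.hom.hom)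
    (hlK : ∀ c, lK c ≫ (bcFunctor E ℂ).map (C.alb K).nabla.incl = (eK c ⊗ₘ eK c) ≫ Functor.LaxMonoidal.μ (bcFunctor E ℂ) (C.X K) (C.X K))
    (hlαK : ∀ c, lK c ≫ (bcFunctor E ℂ).map (C.alb K).α = (JK c).diff ≫ (ιK c ≫ vK).hom.hom.hom)
    (bN : CN → CK) (tu : ∀ c', EN c' ⟶ EK (bN c'))
    (htu : ∀ c', tu c' ≫ eK (bN c') = eN c' ≫ (bcFunctor E ℂ).map (C.cpt.X.map (homOfLE h))) :
    ∃ (H : ∀ c', Subgroup (Aut (EN c'))) (_ : ∀ c', Finite ↥(H c'))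
      (_ : ∀ c', IsSepQuotient (fun h : ↥(H c') => (h : Aut (EN c'))) (tu c'))
      (ttH : ∀ c', (JK (bN c')).J ⟶ (JN c').J) (m : CN → ℕ),
      (∀ c', 0 < m c') ∧
      (∀ c', haveI := Fintype.ofFinite ↥(H c');
        (JN c').pushforward (JK (bN c')) (tu c') ≫ ttH c' =
          ∑ h : ↥(H c'), (JN c').pushforward (JN c') (h : Aut (EN c')).hom) ∧
      (∑ c', πK (bN c') ≫ ((m c' : ℤ) • ttH c') ≫ ιN c') ≫ vN = vK ≫ AbelianVariety.Hom.baseChange ℂ t := by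
  classical
  haveI : ∀ c, IsIntegral (EN c).left := fun c => IsSmoothProjective.isIntegral_holds (hEN c)
  -- the complexified deck action and quotient
  let actC : Δ →* Aut ((bcFunctor E ℂ).obj (C.X N)) :=
    { toFun := fun δ => (bcFunctor E ℂ).mapIso (act δ)
      map_one' := by rw [map_one]; exact (bcFunctor E ℂ).mapIso_refl _
      map_mul' := fun a b => by rw [map_mul]; exact (bcFunctor E ℂ).mapIso_trans (act b) (act a) }
  have hactC : ∀ δ, (actC δ).hom = (bcFunctor E ℂ).map (act δ).hom := fun δ => rfl
  have hXK : IsSeparated (C.X K).hom := by haveI := (C.cpt.projective_X K).isProper; infer_instance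
  obtain ⟨hXsep, hpC⟩ := isSepQuotient_baseChangeHom_of_isProjectiveOver E (algebraMap E ℂ) Δ (C.X N) (C.X K)
    (C.cpt.projective_X N) act (C.cpt.X.map (homOfLE h)) hXK hp
  have hpC' : IsSepQuotient (fun δ => actC δ) ((bcFunctor E ℂ).map (C.cpt.X.map (homOfLE h))) := hpC
  have hXsep' : IsSeparated ((bcFunctor E ℂ).obj (C.X K)).hom := hXsep
  have hX'proj : IsProjectiveOver ((bcFunctor E ℂ).obj (C.X N)) := (C.cpt.projective_X N).baseChange_obj (L := ℂ)
  -- piece lifts of the deck automorphisms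
  have hl := fun δ c₁ => exists_pieceLift actC eN hcN δ c₁
  choose φδ tδ htδ using hl
  -- §1 on the complexified cover
  obtain ⟨H, hfin, hq, ttH, m, hm, httH, hpinY, hcancel⟩ :=
    Jacobian.exists_fan_pullback_word actC ((bcFunctor E ℂ).map (C.cpt.X.map (homOfLE h))) EN eN JN EK eK JK bN tu πN ιN πK ιK
      hιπN hιπN' htotK hιπK hιπK' hX'proj hXsep' hpC' hcN hEN hcK hEK htu φδ tδ htδ
  refine ⟨H, hfin, hq, ttH, m, hm, httH, hcancel ?_⟩
  -- the deck words intertwine the Albanese maps (N1), the trace word is pinned (§1), cancel the word of `u`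
  have hWu := map_baseChange_word EN eN JN YN πN ιN vN lN EK eK JK YK ιK vK lK htotN hlN hlαN hlK hlαK
    (C.cpt.X.map (homOfLE h)) bN tu htu
  have hWδ : ∀ δ, vN ≫ AbelianVariety.Hom.baseChange ℂ ((C.alb N).map (C.alb N) (act δ).hom) =
      (∑ c', πN c' ≫ (JN c').pushforward (JN (φδ δ c')) (tδ δ c') ≫ ιN (φδ δ c')) ≫ vN := fun δ =>
    map_baseChange_word EN eN JN YN πN ιN vN lN EN eN JN YN ιN vN lN htotN hlN hlαN hlN hlαN (act δ).hom (φδ δ) (tδ δ)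
      (htδ δ)
  have hsum : vN ≫ AbelianVariety.Hom.baseChange ℂ (∑ δ, (C.alb N).map (C.alb N) (act δ).hom) =
      (∑ δ, ∑ c', πN c' ≫ (JN c').pushforward (JN (φδ δ c')) (tδ δ c') ≫ ιN (φδ δ c')) ≫ vN := by
    have e1 : AbelianVariety.Hom.baseChange ℂ (∑ δ, (C.alb N).map (C.alb N) (act δ).hom) =
        ∑ δ, AbelianVariety.Hom.baseChange ℂ ((C.alb N).map (C.alb N) (act δ).hom) :=
      map_sum (AddMonoidHom.mk' (fun g : C.A N ⟶ C.A N => AbelianVariety.Hom.baseChange ℂ g)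
        (AbelianVariety.Hom.baseChange_add ℂ)) _ _
    rw [e1, Preadditive.comp_sum, Preadditive.sum_comp]
    exact Finset.sum_congr rfl fun δ _ => hWδ δ
  rw [← Category.assoc, hpinY, ← hsum, ← ht, AbelianVariety.Hom.baseChange_comp, ← Category.assoc, hWu, Category.assoc]

end Sec42Data.HeckeTranslates

end Sec42

end Literature.NumberTheory.Automorphic.Liu2021.AppendixC

end
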